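import Summits.ResolutionOfSingularities.ResolutionOfSingularities.Theorems.WildConesCampaignW46HypersurfacesCharTwoPolarRank

/-!
# [OURS · L1 W4.6, rung (ii) at p = 2, EVERY dimension n] THE NEAR DOUBLE POINT LIES IN THE KERNEL OF
# THE POLAR FORM; in the regime `e ≤ 1` it is UNIQUE (per chart and across charts): the forced procedure
# is deterministic and the infinitely-near double points form a chain — over every field of char 2

HONEST FRAMING. Everything here is OURS: theorems about route WildCones' own TYPED point-blow-up dynamics
(`Theorems/WildConesClassicalRegimesDefs.lean`: states `c`, `step i τ c` = blow up the point, chart `u_i`,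
translate by `τ`, delete squares; `MultP` = double point) and the seat's invariants `CampaignW46.milnorEmbDim`
(p498937: embedding dimension `e(c)` of the Milnor algebra) and `polarMatrix` (p502936: the alternating
matrix `([u_s u_t] a)_{s≠t}` of the cleaned quadratic part, `e(c) + rank = n`). NOTHING here is a
statement of the manuscript [Hironaka2017]; no FACT-LIST premise; AI review is weaker than expert review.
Cell res-hironaka (LADDER-RESOLUTION rung L, D-0089), slot W4.6, seat res-L1-s46-pv-4 (gen 3); host route
`WildCones`, crux `ClassicalRegimes` (stmt-ResolutionOfSingularities-16884; proved). It extends the seat's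
gen-2 threefold file `…ThreefoldsCharTwoNearPoint.lean` (p482242: `threefold_nearPoint_formula/unique/charts`)
to every dimension, replacing the hyperbolic pair `{j, l}` by the kernel of the polar form.

WHAT IS PROVED (every `n`, every field of characteristic `2`):

* `vecMul_polarMatrix_dotProduct_self` — the polar form is ALTERNATING (`x·P·x = 0`);
  `polarMatrix_transpose` — and symmetric; `mem_ker_polarMatrix_iff`.
* `vecMul_nearPoint_polarMatrix` — if a double state has a DOUBLE successor in chart `i` at translation
  `τ`, the homogeneous coordinate vector `w = (τ with w_i = 1)` of the visited point of the exceptional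
  divisor satisfies `w · P = 0` (off `i`: the linear coefficients of the strict transform,
  `coeff_single_strict`; at `i`: alternation). The state's regime is not needed.
* `finrank_ker_polarMatrix` — `dim ker P = e(c)`.
* `hypersurface_nearPoint_unique` (`e ≤ 1`: two translations in one chart with double successors agree
  off the chart index), `hypersurface_nearPoint_charts` (across charts `i ≠ i'`: `τ_{i'} ≠ 0`,
  `τ'_i = τ_{i'}⁻¹`, `τ'_m = τ_{i'}⁻¹ τ_m`), `hypersurface_nearPoint_unique'` (the near vectors coincide):
  in the regime `e ≤ 1` there is AT MOST ONE infinitely-near double point — it replaces the role of the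
  DETERMINACY of the next centre (Th. 16.6 p.84 L5–L6, `D′ = ∇′ ∩ π⁻¹(D)`) in this regime, NOT a statement
  of the manuscript; with closure (`hypersurface_regime_step`, p501990) the infinitely-near double points
  above a state of the regime form a CHAIN of length `≤ μ/2`.

References: G.-M. Greuel, G. Pfister, J. Algebra 689 (2026) [GreuelPfister2026] (context); H. Hironaka,
ms. 2017 [Hironaka2017] Th. 16.6 p.84 — role replaced only, under adjudication.
-/

noncomputable section

-- single-problem summit: the doubled namespace component `ResolutionOfSingularities` is forced
set_option linter.dupNamespace false

open scoped BigOperators Classical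

open MvPowerSeries IsLocalRing

open Literature.AlgebraicGeometry.Resolution

namespace Summit.ResolutionOfSingularities.ResolutionOfSingularities.Theorems

namespace CampaignW46.HypersurfacesCharTwo

open WildCones WildCones.MuDropCharTwoOrdP ThreefoldsCharTwo

variable {κ : Type} [Field κ] {n : ℕ}

/-! ## The polar matrix is alternating -/

/-- [OURS · L1 W4.6] The polar matrix is symmetric. [folklore] -/
theorem polarMatrix_symm (f : MvPowerSeries (Fin n) κ) (s t : Fin n) :
    polarMatrix f s t = polarMatrix f t s := by
  simp only [polarMatrix, Matrix.of_apply]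
  by_cases h : s = t
  · subst h; rfl
  · rw [if_neg h, if_neg (Ne.symm h), add_comm]

/-- [OURS · L1 W4.6] The polar matrix is symmetric (transpose form). [folklore] -/
theorem polarMatrix_transpose (f : MvPowerSeries (Fin n) κ) :
    (polarMatrix f).transpose = polarMatrix f := by
  ext s t
  exact polarMatrix_symm f t s

/-- [OURS · L1 W4.6] The polar matrix has zero diagonal. [folklore] -/
theorem polarMatrix_diag (f : MvPowerSeries (Fin n) κ) (s : Fin n) : polarMatrix f s s = 0 := by
  simp [polarMatrix]

/-- [OURS · L1 W4.6] **The polar form is ALTERNATING in characteristic two**: `x · P · x = 0` for every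
vector `x` (zero diagonal, symmetric, and `2 = 0`). [folklore] -/
theorem vecMul_polarMatrix_dotProduct_self [CharP κ 2] (f : MvPowerSeries (Fin n) κ) (x : Fin n → κ) :
    Matrix.vecMul x (polarMatrix f) ⬝ᵥ x = 0 := by
  -- the double sum over ordered pairs cancels in swapped pairs
  have hsum : Matrix.vecMul x (polarMatrix f) ⬝ᵥ x =
      ∑ p : Fin n × Fin n, x p.2 * polarMatrix f p.2 p.1 * x p.1 := by
    rw [Fintype.sum_prod_type]
    simp only [dotProduct, Matrix.vecMul, Finset.sum_mul]
  rw [hsum]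
  refine Finset.sum_ninvolution Prod.swap (fun p => ?_) (fun p hp => ?_) (fun _ => Finset.mem_univ _)
    (fun p => Prod.swap_swap p)
  · rw [Prod.fst_swap, Prod.snd_swap, polarMatrix_symm f p.1 p.2,
      show x p.1 * polarMatrix f p.2 p.1 * x p.2 = x p.2 * polarMatrix f p.2 p.1 * x p.1 by ring]
    exact CharTwo.add_self_eq_zero _
  · intro h
    apply hp
    have : p.2 = p.1 := by rw [Prod.ext_iff] at h; exact h.1
    rw [this, polarMatrix_diag, mul_zero, zero_mul]

/-- [OURS · L1 W4.6] `P *ᵥ x = x ᵥ* P` for the (symmetric) polar matrix. [folklore] -/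
theorem mulVec_polarMatrix_eq_vecMul (f : MvPowerSeries (Fin n) κ) (x : Fin n → κ) :
    Matrix.mulVec (polarMatrix f) x = Matrix.vecMul x (polarMatrix f) := by
  rw [← Matrix.mulVec_transpose, polarMatrix_transpose]

/-- [OURS · L1 W4.6] Membership in the kernel of the polar matrix. [folklore] -/
theorem mem_ker_polarMatrix_iff (f : MvPowerSeries (Fin n) κ) (x : Fin n → κ) :
    x ∈ LinearMap.ker (polarMatrix f).mulVecLin ↔ Matrix.vecMul x (polarMatrix f) = 0 := by
  rw [LinearMap.mem_ker, Matrix.mulVecLin_apply, mulVec_polarMatrix_eq_vecMul]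

/-! ## The near double point lies in the kernel of the polar form -/

/-- [OURS · L1 W4.6 rung (ii) at `p = 2`, every dimension; NOT a statement of the manuscript] **THE NEAR
DOUBLE POINT IS IN THE KERNEL OF THE POLAR FORM.** Hypersurface double points `z² = a(u₁,…,uₙ)` over any
field of characteristic `2`: if a double state `c` has a DOUBLE point as point-blow-up successor in chart
`i` at translation `τ`, then the vector `w = (τ with w_i = 1)` — the homogeneous coordinates of the
visited point of the exceptional divisor — satisfies `w · P = 0` for the polar matrix `P` of the cleaned
quadratic part: off the chart index this is the vanishing of the linear coefficients of the strict
transform (`coeff_single_strict`), at the chart index it follows because the form is alternating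
(`vecMul_polarMatrix_dotProduct_self`). (`n = 3`: gen 2's `threefold_nearPoint_formula`.) [folklore] -/
theorem vecMul_nearPoint_polarMatrix [CharP κ 2] (c : (Fin n → ℕ) → κ) (i : Fin n) (τ : Fin n → κ)
    (hM : MultP 2 n κ c) (hM' : MultP 2 n κ (step 2 n κ i τ c)) :
    Matrix.vecMul (Function.update τ i 1) (polarMatrix (ser 2 n κ c)) = 0 := by
  set w : Fin n → κ := Function.update τ i 1 with hw
  have hwi : w i = 1 := by rw [hw, Function.update_self]
  have hws : ∀ s, s ≠ i → w s = τ s := fun s hs => by rw [hw, Function.update_of_ne hs]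
  -- off the chart index
  have hoff : ∀ m, m ≠ i → Matrix.vecMul w (polarMatrix (ser 2 n κ c)) m = 0 := by
    intro m hm
    have h := coeff_single_strict i τ (two_le_order_ser hM) (X_pow_mul_serT_eq_subst c i τ hM) hm
    rw [coeff_single_serT le_rfl c i τ hM hM' m] at h
    have hexp : Matrix.vecMul w (polarMatrix (ser 2 n κ c)) m =
        coeff (Finsupp.single i 1 + Finsupp.single m 1) (ser 2 n κ c) +
          ∑ s ∈ Finset.univ.erase i, τ s * ((((Finsupp.single s 1 : Fin n →₀ ℕ) m : ℕ) : κ) + 1) *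
            coeff (Finsupp.single s 1 + Finsupp.single m 1) (ser 2 n κ c) := by
      simp only [Matrix.vecMul, dotProduct]
      rw [← Finset.add_sum_erase _ _ (Finset.mem_univ i), hwi, one_mul]
      congr 1
      · simp [polarMatrix, Ne.symm hm]
      · refine Finset.sum_congr rfl fun s hs => ?_
        have hsi : s ≠ i := Finset.ne_of_mem_erase hs
        rw [hws s hsi]
        by_cases hsm : s = m
        · subst hsm
          have h2 : (((Finsupp.single s 1 : Fin n →₀ ℕ) s : ℕ) : κ) + 1 = 0 := by
            rw [Finsupp.single_eq_same, Nat.cast_one]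
            exact CharTwo.add_self_eq_zero 1
          rw [h2, mul_zero, zero_mul, polarMatrix_diag, mul_zero]
        · have h2 : (((Finsupp.single s 1 : Fin n →₀ ℕ) m : ℕ) : κ) + 1 = 1 := by
            rw [Finsupp.single_apply, if_neg hsm, Nat.cast_zero, zero_add]
          rw [h2, mul_one]
          simp only [polarMatrix, Matrix.of_apply, if_neg hsm]
    rw [hexp]
    exact h.symm
  -- at the chart index, by the alternating property
  have hi : Matrix.vecMul w (polarMatrix (ser 2 n κ c)) i = 0 := by
    have halt := vecMul_polarMatrix_dotProduct_self (ser 2 n κ c) w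
    rw [dotProduct, ← Finset.add_sum_erase _ _ (Finset.mem_univ i), hwi, mul_one,
      Finset.sum_eq_zero (fun m hm => by rw [hoff m (Finset.ne_of_mem_erase hm), zero_mul]),
      add_zero] at halt
    exact halt
  funext m
  by_cases hm : m = i
  · rw [hm, hi, Pi.zero_apply]
  · rw [hoff m hm, Pi.zero_apply]

/-- [OURS · L1 W4.6; NOT a statement of the manuscript] **The kernel of the polar form has dimension
`e(c)`** (double state, characteristic `2`): rank–nullity with `milnorEmbDim_add_rank_polarMatrix`.
[folklore] -/
theorem finrank_ker_polarMatrix [CharP κ 2] {c : (Fin n → ℕ) → κ} (hM : MultP 2 n κ c) :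
    Module.finrank κ (LinearMap.ker (polarMatrix (ser 2 n κ c)).mulVecLin) = milnorEmbDim 2 n κ c := by
  have h1 := LinearMap.finrank_range_add_finrank_ker (polarMatrix (ser 2 n κ c)).mulVecLin
  rw [Module.finrank_fin_fun] at h1
  have h2 := milnorEmbDim_add_rank_polarMatrix hM
  unfold Matrix.rank at h2
  omega

/-! ## Uniqueness of the infinitely-near double point in the regime `e ≤ 1` -/

/-- [OURS · L1 W4.6 rung (ii) at `p = 2`, every dimension; NOT a statement of the manuscript]
**UNIQUENESS OF THE INFINITELY-NEAR DOUBLE POINT, per chart** (`z² = a(u₁,…,uₙ)`, any field of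
characteristic `2`): for a double state `c` with `e(c) ≤ 1` (polar form of corank `≤ 1`), if two
translations `τ, τ'` in the same chart `i` both give a double point as successor, they agree off the
chart index: the forced procedure is DETERMINISTIC in the regime. (Both near vectors lie in the kernel
of the polar form, of dimension `e(c) ≤ 1`, and have `i`-th coordinate `1`.) (`n = 3`: gen 2's
`threefold_nearPoint_unique`.) [folklore] -/
theorem hypersurface_nearPoint_unique [CharP κ 2] (c : (Fin n → ℕ) → κ) (i : Fin n)
    (τ τ' : Fin n → κ) (hM : MultP 2 n κ c) (he : milnorEmbDim 2 n κ c ≤ 1)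
    (hτ : MultP 2 n κ (step 2 n κ i τ c)) (hτ' : MultP 2 n κ (step 2 n κ i τ' c)) :
    ∀ m ≠ i, τ m = τ' m := by
  set K := LinearMap.ker (polarMatrix (ser 2 n κ c)).mulVecLin with hK
  have hw : Function.update τ i 1 ∈ K :=
    (mem_ker_polarMatrix_iff _ _).mpr (vecMul_nearPoint_polarMatrix c i τ hM hτ)
  have hw' : Function.update τ' i 1 ∈ K :=
    (mem_ker_polarMatrix_iff _ _).mpr (vecMul_nearPoint_polarMatrix c i τ' hM hτ')
  have hfr : Module.finrank κ K ≤ 1 := by rw [hK, finrank_ker_polarMatrix hM]; exact he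
  obtain ⟨v, hv⟩ := finrank_le_one_iff.mp hfr
  obtain ⟨a, ha⟩ := hv ⟨_, hw⟩
  obtain ⟨a', ha'⟩ := hv ⟨_, hw'⟩
  have hva : a • (v : Fin n → κ) = Function.update τ i 1 := congrArg Subtype.val ha
  have hva' : a' • (v : Fin n → κ) = Function.update τ' i 1 := congrArg Subtype.val ha'
  have hai : a * (v : Fin n → κ) i = 1 := by
    have := congrFun hva i
    rwa [Pi.smul_apply, smul_eq_mul, Function.update_self] at this
  have hai' : a' * (v : Fin n → κ) i = 1 := by
    have := congrFun hva' i
    rwa [Pi.smul_apply, smul_eq_mul, Function.update_self] at this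
  have hvi : (v : Fin n → κ) i ≠ 0 := fun h0 => by
    rw [h0, mul_zero] at hai
    exact zero_ne_one hai
  have haa' : a = a' := mul_right_cancel₀ hvi (hai.trans hai'.symm)
  intro m hm
  have h1 := congrFun hva m
  have h2 := congrFun hva' m
  rw [Pi.smul_apply, smul_eq_mul, Function.update_of_ne hm] at h1 h2
  rw [← h1, ← h2, haa']

/-- [OURS · L1 W4.6 rung (ii) at `p = 2`, every dimension; NOT a statement of the manuscript] **THE
NEAR DOUBLE POINT ACROSS CHARTS**: for a double state with `e(c) ≤ 1`, if chart `i` at `τ` and chart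
`i' ≠ i` at `τ'` both give a double point as successor, then the two visited points of the exceptional
divisor COINCIDE: `τ_{i'} ≠ 0`, `τ'_i = τ_{i'}⁻¹`, and `τ'_m = τ_{i'}⁻¹ τ_m` for `m ∉ {i, i'}` — one
projective point `[w] = ker P`. (`n = 3`: gen 2's `threefold_nearPoint_charts`.) [folklore] -/
theorem hypersurface_nearPoint_charts [CharP κ 2] (c : (Fin n → ℕ) → κ) {i i' : Fin n} (hii' : i ≠ i')
    (τ τ' : Fin n → κ) (hM : MultP 2 n κ c) (he : milnorEmbDim 2 n κ c ≤ 1)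
    (hτ : MultP 2 n κ (step 2 n κ i τ c)) (hτ' : MultP 2 n κ (step 2 n κ i' τ' c)) :
    τ i' ≠ 0 ∧ τ' i = (τ i')⁻¹ ∧ ∀ m, m ≠ i → m ≠ i' → τ' m = (τ i')⁻¹ * τ m := by
  set K := LinearMap.ker (polarMatrix (ser 2 n κ c)).mulVecLin with hK
  have hw : Function.update τ i 1 ∈ K :=
    (mem_ker_polarMatrix_iff _ _).mpr (vecMul_nearPoint_polarMatrix c i τ hM hτ)
  have hw' : Function.update τ' i' 1 ∈ K :=
    (mem_ker_polarMatrix_iff _ _).mpr (vecMul_nearPoint_polarMatrix c i' τ' hM hτ')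
  have hfr : Module.finrank κ K ≤ 1 := by rw [hK, finrank_ker_polarMatrix hM]; exact he
  obtain ⟨v, hv⟩ := finrank_le_one_iff.mp hfr
  obtain ⟨a, ha⟩ := hv ⟨_, hw⟩
  obtain ⟨a', ha'⟩ := hv ⟨_, hw'⟩
  have hva : a • (v : Fin n → κ) = Function.update τ i 1 := congrArg Subtype.val ha
  have hva' : a' • (v : Fin n → κ) = Function.update τ' i' 1 := congrArg Subtype.val ha'
  have hai : a * (v : Fin n → κ) i = 1 := by
    have := congrFun hva i
    rwa [Pi.smul_apply, smul_eq_mul, Function.update_self] at this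
  have hai' : a' * (v : Fin n → κ) i' = 1 := by
    have := congrFun hva' i'
    rwa [Pi.smul_apply, smul_eq_mul, Function.update_self] at this
  have hτi' : τ i' = a * (v : Fin n → κ) i' := by
    have := congrFun hva i'
    rw [Pi.smul_apply, smul_eq_mul, Function.update_of_ne (Ne.symm hii')] at this
    exact this.symm
  have hτ'i : τ' i = a' * (v : Fin n → κ) i := by
    have := congrFun hva' i
    rw [Pi.smul_apply, smul_eq_mul, Function.update_of_ne hii'] at this
    exact this.symm
  have ha0 : a ≠ 0 := fun h0 => by rw [h0, zero_mul] at hai; exact zero_ne_one hai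
  have hvi' : (v : Fin n → κ) i' ≠ 0 := fun h0 => by rw [h0, mul_zero] at hai'; exact zero_ne_one hai'
  have hne : τ i' ≠ 0 := by rw [hτi']; exact mul_ne_zero ha0 hvi'
  have hinv : (τ i')⁻¹ = a' * (v : Fin n → κ) i := by
    rw [hτi']
    refine inv_eq_of_mul_eq_one_right ?_
    linear_combination (a' * (v : Fin n → κ) i') * hai + hai'
  refine ⟨hne, by rw [hτ'i, hinv], fun m hmi hmi' => ?_⟩
  have h1 := congrFun hva m
  have h2 := congrFun hva' m
  rw [Pi.smul_apply, smul_eq_mul, Function.update_of_ne hmi] at h1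
  rw [Pi.smul_apply, smul_eq_mul, Function.update_of_ne hmi'] at h2
  rw [← h2, hinv, ← h1]
  linear_combination (-(a' * (v : Fin n → κ) m)) * hai

/-- [OURS · L1 W4.6 rung (ii) at `p = 2`, every dimension; NOT a statement of the manuscript] **In the
regime `e ≤ 1` every state has AT MOST ONE infinitely-near double point**: combining the two previous
theorems, two (chart, translation) pairs with double successors visit the same point of the exceptional
divisor; in particular the forced (isolated-double-successor) procedure of crux `ClassicalRegimes` is
deterministic on the regime, and the tree of infinitely-near double points above a state of the regime
is a CHAIN (by closure, `hypersurface_regime_step`). Stated per chart: the translation is unique off the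
chart index. [folklore] -/
theorem hypersurface_nearPoint_unique' [CharP κ 2] (c : (Fin n → ℕ) → κ) (hM : MultP 2 n κ c)
    (he : milnorEmbDim 2 n κ c ≤ 1) (i : Fin n) :
    ∀ τ τ' : Fin n → κ, MultP 2 n κ (step 2 n κ i τ c) → MultP 2 n κ (step 2 n κ i τ' c) →
      Function.update τ i 1 = Function.update τ' i 1 := by
  intro τ τ' hτ hτ'
  funext m
  by_cases hm : m = i
  · rw [hm, Function.update_self, Function.update_self]
  · rw [Function.update_of_ne hm, Function.update_of_ne hm]
    exact hypersurface_nearPoint_unique c i τ τ' hM he hτ hτ' m hm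

end CampaignW46.HypersurfacesCharTwo

end Summit.ResolutionOfSingularities.ResolutionOfSingularities.Theorems

end
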